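import Mathlib
import HarnessLib
import Literature.MathematicalPhysics.QuantumLattice.HubbardEffectiveActionCT
import Summits.HubbardSuperconductivity.HubbardSuperconductivity.Theorems.KLProgrammeKLRegimeCountertermJacksonKernel

/-!
# Route `KLProgramme` — crux K3, child Counterterm under Δ23 / (R-I-min): the JACKSON MEAN of a symmetric frame as a `TrigPolyC4v` (part 2 of the smoothing layer)

The two-dimensional smoothing operator of child Counterterm's (R-I-min) Picard step, `(𝒥_d F)(p) := ∫∫_{[−π,π]²} J̃_d(s) J̃_d(t) F(p₀−s, p₁−t) dt ds`
(`J̃_d` the `2π`-periodic Jackson kernel of `…CountertermJacksonKernel`), and its presentation as a FRAME of the model's unchanged carrier: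

* §3 `integral_comp_sub_of_periodic`, `integral_eq_zero_of_odd`, **`integral_jker_mul_comp_sub`** — smoothing a continuous `2π`-periodic EVEN
  function: `∫ J̃_d(t) g(x−t) dt = Σ_{l ≤ 2d} ĵ_l cos(l x) ∫ cos(l u) g(u) du` (shift invariance + the cosine form of `J̃_d`; oddness kills the sines);
* §4 `jsmooth d F`, `cosMoment F k l` (`= ∫ cos(ks) ∫ cos(lu) F(s,u)`), **`jacksonFrame d F : TrigPolyC4v`** (degree `2d`, coefficients `ĵ_k ĵ_l A_F(k,l)`);
  for `F` continuous, `2π`-periodic, reflection- and swap-symmetric (p2's `IsSymmetricFrame`, taken UNBUNDLED as `hper/hrefl/hswap` so that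
  `IsSymmetricFrame F` feeds them as `h.1/h.2.1/h.2.2`): `jsmooth_eq_sum` (double cosine sum), `cosMoment_symm` (Fubini), and
  **`eval_jacksonFrame` (J1): `(jacksonFrame d F).eval p = jsmooth d F p`** — the smoothed symbol IS a `TrigPolyC4v`, so the model, `FrameOK`,
  `Preds` and every `∀ K : TrigPolyC4v` binder stay untouched under (R-I-min).

Parts 3/4 (`…CountertermJacksonFrameBounds`, `…CountertermJacksonFrameDeriv`): constants reproduced, linearity, `|𝒥_d F| ≤ sup|F|` (positivity, mass
one), the value error `|𝒥_d F − F| ≤ π⁶·‖∇F‖_∞/(d+1)`, and `‖Dʲ(𝒥_d F)‖ ≤ sup‖DʲF‖` with constant ONE.  Pure real analysis.  Seat hubbard-kl-k3c3-p2 (g3);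
HOME/hubbard-kl-k3c3-p2/DELTA23-CHILD2.md §3.
-/

noncomputable section

namespace Summit.HubbardSuperconductivity.HubbardSuperconductivity.Theorems.KLRegimeSplit

set_option linter.dupNamespace false -- summit = problem name (single-conjunct summit), D-0017

open Real Finset MeasureTheory intervalIntegral
open Literature.Analysis.Fourier.TrigApprox Literature.MathematicalPhysics.QuantumLattice

/-! ## §3 One-dimensional smoothing of periodic even functions -/

/-- Shift invariance of the integral over a period: `∫_{−π}^{π} g(x − t) dt = ∫_{−π}^{π} g`. -/
theorem integral_comp_sub_of_periodic {g : ℝ → ℝ} (hg : Function.Periodic g (2 * π)) (x : ℝ) :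
    ∫ t in (-π)..π, g (x - t) = ∫ t in (-π)..π, g t := by
  rw [intervalIntegral.integral_comp_sub_left (fun t => g t) x]
  have h := hg.intervalIntegral_add_eq (x - π) (-π)
  rw [show x - π + 2 * π = x + π by ring, show -π + 2 * π = π by ring] at h
  rw [show x - -π = x + π by ring]
  exact h

/-- The integral of an odd function over `[−a, a]` vanishes. -/
theorem integral_eq_zero_of_odd {g : ℝ → ℝ} (hodd : ∀ t, g (-t) = -g t) (a : ℝ) : ∫ t in (-a)..a, g t = 0 := by
  have h1 : ∫ t in (-a)..a, g (-t) = ∫ t in (-a)..a, g t := by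
    rw [intervalIntegral.integral_comp_neg (fun t => g t)]; simp
  have h2 : ∫ t in (-a)..a, g (-t) = -∫ t in (-a)..a, g t := by
    rw [← intervalIntegral.integral_neg]; exact intervalIntegral.integral_congr fun t _ => hodd t
  linarith

/-- **Smoothing a periodic even function by `J̃_d`**: `∫_{−π}^{π} J̃_d(t) g(x − t) dt = Σ_{l ≤ 2d} ĵ_l cos(l x) ∫_{−π}^{π} cos(l u) g(u) du`
for `g` continuous, `2π`-periodic and even. -/
theorem integral_jker_mul_comp_sub (d : ℕ) {g : ℝ → ℝ} (hc : Continuous g) (hper : Function.Periodic g (2 * π))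
    (heven : ∀ t, g (-t) = g t) (x : ℝ) :
    ∫ t in (-π)..π, jker d t * g (x - t) =
      ∑ l ∈ range (d + d + 1), jkerCoeff d l * Real.cos (l * x) * ∫ u in (-π)..π, Real.cos (l * u) * g u := by
  -- shift: `∫ J(t) g(x−t) dt = ∫ J(x−u) g(u) du`
  have hshift : ∫ t in (-π)..π, jker d t * g (x - t) = ∫ u in (-π)..π, jker d (x - u) * g u := by
    have hper' : Function.Periodic (fun u => jker d (x - u) * g u) (2 * π) := by
      intro u
      simp only
      rw [show x - (u + 2 * π) = (x - u) + -1 * (2 * π) by ring]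
      rw [show (x - u) + -1 * (2 * π) = (x - u) - 2 * π by ring, (jker_periodic d).sub_eq, hper u]
    have h := integral_comp_sub_of_periodic hper' x
    simp only [sub_sub_cancel] at h
    exact h
  rw [hshift]
  -- expand the kernel and split `cos(l(x − u))`
  have hexp : ∀ u, jker d (x - u) * g u =
      ∑ l ∈ range (d + d + 1), (jkerCoeff d l * Real.cos (l * x) * (Real.cos (l * u) * g u) +
        jkerCoeff d l * Real.sin (l * x) * (Real.sin (l * u) * g u)) := by
    intro u
    rw [jker_eq_cosPoly, Finset.sum_mul]
    refine Finset.sum_congr rfl fun l _ => ?_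
    rw [mul_sub, Real.cos_sub]; ring
  simp_rw [hexp]
  rw [intervalIntegral.integral_finsetSum (fun l _ => ?_)]
  · refine Finset.sum_congr rfl fun l _ => ?_
    rw [intervalIntegral.integral_add (by apply Continuous.intervalIntegrable; fun_prop)
      (by apply Continuous.intervalIntegrable; fun_prop),
      intervalIntegral.integral_const_mul, intervalIntegral.integral_const_mul]
    have hodd : ∫ u in (-π)..π, Real.sin (l * u) * g u = 0 :=
      integral_eq_zero_of_odd (fun t => by rw [mul_neg, Real.sin_neg, heven, neg_mul]) π
    rw [hodd, mul_zero, add_zero]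
  · apply Continuous.intervalIntegrable; fun_prop

/-! ## §4 The two-dimensional smoothing operator and its presentation as a frame -/

/-- **The Jackson mean of order `d` of a function on the Brillouin zone**: `(𝒥_d F)(p) = ∫∫_{[−π,π]²} J̃_d(s) J̃_d(t) F(p₀ − s, p₁ − t) dt ds`. -/
def jsmooth (d : ℕ) (F : (Fin 2 → ℝ) → ℝ) (p : Fin 2 → ℝ) : ℝ :=
  ∫ s in (-π)..π, ∫ t in (-π)..π, jker d s * jker d t * F ![p 0 - s, p 1 - t]

/-- The double cosine moments `A_F(k,l) = ∫_{−π}^{π} cos(k s) (∫_{−π}^{π} cos(l u) F(s,u) du) ds`. -/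
def cosMoment (F : (Fin 2 → ℝ) → ℝ) (k l : ℕ) : ℝ :=
  ∫ s in (-π)..π, Real.cos (k * s) * ∫ u in (-π)..π, Real.cos (l * u) * F ![s, u]

/-- **The Jackson mean as a frame**: the `TrigPolyC4v` of degree `2d` with coefficients `ĵ_k ĵ_l A_F(k,l)`. -/
def jacksonFrame (d : ℕ) (F : (Fin 2 → ℝ) → ℝ) : TrigPolyC4v :=
  ⟨d + d, fun k l => jkerCoeff d k * jkerCoeff d l * cosMoment F k l⟩

section Symmetric

variable {F : (Fin 2 → ℝ) → ℝ}

/-- A swap-symmetric frame even in the second coordinate is even in the first coordinate too. -/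
theorem symm_refl_fst (hrefl : ∀ p : Fin 2 → ℝ, F ![p 0, -p 1] = F p) (hswap : ∀ p : Fin 2 → ℝ, F ![p 1, p 0] = F p)
    (a u : ℝ) : F ![-a, u] = F ![a, u] := by
  have h1 := hswap ![-a, u]
  have h2 := hrefl ![u, a]
  have h3 := hswap ![u, a]
  simp only [Matrix.cons_val_zero, Matrix.cons_val_one] at h1 h2 h3
  rw [← h1, h2, h3]

/-- Periodicity in the second coordinate. -/
theorem symm_add_two_pi_snd (hper : ∀ (p : Fin 2 → ℝ) (z : Fin 2 → ℤ), F (fun i => p i + z i * (2 * π)) = F p)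
    (a u : ℝ) : F ![a, u + 2 * π] = F ![a, u] := by
  have h := hper ![a, u] ![0, 1]
  rw [← h]
  congr 1
  ext i; fin_cases i <;> simp

/-- Periodicity in the first coordinate. -/
theorem symm_add_two_pi_fst (hper : ∀ (p : Fin 2 → ℝ) (z : Fin 2 → ℤ), F (fun i => p i + z i * (2 * π)) = F p)
    (a u : ℝ) : F ![a + 2 * π, u] = F ![a, u] := by
  have h := hper ![a, u] ![1, 0]
  rw [← h]
  congr 1
  ext i; fin_cases i <;> simp

/-- Continuity of the sections `u ↦ F(a, u)`. -/
theorem symm_continuous_snd (hc : Continuous F) (a : ℝ) : Continuous fun u => F ![a, u] := by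
  refine hc.comp ?_
  refine continuous_pi fun i => ?_
  fin_cases i <;> simp <;> fun_prop

/-- Joint continuity of `(a, u) ↦ cos(l u) F(a, u)`. -/
theorem symm_continuous_uncurry (hc : Continuous F) (l : ℕ) :
    Continuous (Function.uncurry fun a u => Real.cos (l * u) * F ![a, u]) := by
  have h1 : Continuous fun q : ℝ × ℝ => F ![q.1, q.2] := by
    refine hc.comp ?_
    refine continuous_pi fun i => ?_
    fin_cases i <;> simp <;> fun_prop
  exact (by fun_prop : Continuous fun q : ℝ × ℝ => Real.cos (l * q.2)).mul h1

/-- The partial cosine moment `C_l(a) = ∫ cos(l u) F(a,u) du` is continuous, `2π`-periodic and even in `a`. -/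
theorem symm_partialMoment (hc : Continuous F)
    (hper : ∀ (p : Fin 2 → ℝ) (z : Fin 2 → ℤ), F (fun i => p i + z i * (2 * π)) = F p)
    (hrefl : ∀ p : Fin 2 → ℝ, F ![p 0, -p 1] = F p) (hswap : ∀ p : Fin 2 → ℝ, F ![p 1, p 0] = F p) (l : ℕ) :
    Continuous (fun a => ∫ u in (-π)..π, Real.cos (l * u) * F ![a, u]) ∧
      Function.Periodic (fun a => ∫ u in (-π)..π, Real.cos (l * u) * F ![a, u]) (2 * π) ∧
        ∀ a, (∫ u in (-π)..π, Real.cos (l * u) * F ![-a, u]) = ∫ u in (-π)..π, Real.cos (l * u) * F ![a, u] := by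
  refine ⟨intervalIntegral.continuous_parametric_intervalIntegral_of_continuous' (symm_continuous_uncurry hc l) _ _,
    fun a => ?_, fun a => ?_⟩
  · exact intervalIntegral.integral_congr fun u _ => by
      show Real.cos (l * u) * F ![a + 2 * π, u] = Real.cos (l * u) * F ![a, u]
      rw [symm_add_two_pi_fst hper a u]
  · exact intervalIntegral.integral_congr fun u _ => by
      show Real.cos (l * u) * F ![-a, u] = Real.cos (l * u) * F ![a, u]
      rw [symm_refl_fst hrefl hswap a u]

/-- **The Jackson mean as a double cosine sum**: `(𝒥_d F)(p) = Σ_{k,l ≤ 2d} ĵ_k ĵ_l A_F(k,l) cos(k p₀) cos(l p₁)` for `F` continuous,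
`2π`-periodic, even in the second coordinate and swap-symmetric. -/
theorem jsmooth_eq_sum (hc : Continuous F)
    (hper : ∀ (p : Fin 2 → ℝ) (z : Fin 2 → ℤ), F (fun i => p i + z i * (2 * π)) = F p)
    (hrefl : ∀ p : Fin 2 → ℝ, F ![p 0, -p 1] = F p) (hswap : ∀ p : Fin 2 → ℝ, F ![p 1, p 0] = F p)
    (d : ℕ) (p : Fin 2 → ℝ) :
    jsmooth d F p = ∑ k ∈ range (d + d + 1), ∑ l ∈ range (d + d + 1),
      jkerCoeff d k * jkerCoeff d l * cosMoment F k l * (Real.cos (k * p 0) * Real.cos (l * p 1)) := by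
  unfold jsmooth cosMoment
  -- inner integral in `t`
  have hinner : ∀ s, (∫ t in (-π)..π, jker d s * jker d t * F ![p 0 - s, p 1 - t]) =
      jker d s * ∑ l ∈ range (d + d + 1), jkerCoeff d l * Real.cos (l * p 1) *
        ∫ u in (-π)..π, Real.cos (l * u) * F ![p 0 - s, u] := by
    intro s
    have h := integral_jker_mul_comp_sub d (symm_continuous_snd hc (p 0 - s))
      (fun u => symm_add_two_pi_snd hper (p 0 - s) u) (fun t => by
        have := hrefl ![p 0 - s, t]
        simpa using this) (p 1)
    rw [← h, ← intervalIntegral.integral_const_mul]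
    exact intervalIntegral.integral_congr fun t _ => by ring
  simp_rw [hinner]
  rw [show (fun s => jker d s * ∑ l ∈ range (d + d + 1), jkerCoeff d l * Real.cos (l * p 1) *
        ∫ u in (-π)..π, Real.cos (l * u) * F ![p 0 - s, u]) =
      fun s => ∑ l ∈ range (d + d + 1), jkerCoeff d l * Real.cos (l * p 1) *
        (jker d s * ∫ u in (-π)..π, Real.cos (l * u) * F ![p 0 - s, u]) from
      funext fun s => by rw [Finset.mul_sum]; exact Finset.sum_congr rfl fun l _ => by ring]
  have hint : ∀ l ∈ range (d + d + 1), IntervalIntegrable (fun s => jkerCoeff d l * Real.cos (l * p 1) *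
      (jker d s * ∫ u in (-π)..π, Real.cos (l * u) * F ![p 0 - s, u])) volume (-π) π := by
    intro l _
    apply Continuous.intervalIntegrable
    have hC := (symm_partialMoment hc hper hrefl hswap l).1
    exact continuous_const.mul ((continuous_jker d).mul (hC.comp (continuous_const.sub continuous_id)))
  rw [intervalIntegral.integral_finsetSum hint, Finset.sum_comm]
  refine Finset.sum_congr rfl fun l _ => ?_
  rw [intervalIntegral.integral_const_mul]
  -- outer integral in `s`
  obtain ⟨hCc, hCp, hCe⟩ := symm_partialMoment hc hper hrefl hswap l
  have h := integral_jker_mul_comp_sub d hCc hCp hCe (p 0)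
  rw [h, Finset.mul_sum]
  exact Finset.sum_congr rfl fun k _ => by ring

/-- The cosine moments of a swap-symmetric continuous function are symmetric: `A_F(k,l) = A_F(l,k)` (Fubini). -/
theorem cosMoment_symm (hc : Continuous F) (hswap : ∀ p : Fin 2 → ℝ, F ![p 1, p 0] = F p) (k l : ℕ) :
    cosMoment F k l = cosMoment F l k := by
  unfold cosMoment
  have h1 : ∀ s, Real.cos (k * s) * (∫ u in (-π)..π, Real.cos (l * u) * F ![s, u]) =
      ∫ u in (-π)..π, Real.cos (k * s) * (Real.cos (l * u) * F ![s, u]) := fun s =>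
    (intervalIntegral.integral_const_mul _ _).symm
  have h2 : ∀ u, Real.cos (l * u) * (∫ s in (-π)..π, Real.cos (k * s) * F ![u, s]) =
      ∫ s in (-π)..π, Real.cos (l * u) * (Real.cos (k * s) * F ![u, s]) := fun u =>
    (intervalIntegral.integral_const_mul _ _).symm
  simp_rw [h1, h2]
  rw [MeasureTheory.intervalIntegral_intervalIntegral_swap]
  · refine intervalIntegral.integral_congr fun u _ => intervalIntegral.integral_congr fun s _ => ?_
    have hs := hswap ![u, s]
    simp only [Matrix.cons_val_one, Matrix.cons_val_zero] at hs
    simp only [hs]; ring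
  · have hcont : Continuous (Function.uncurry fun s u => Real.cos (k * s) * (Real.cos (l * u) * F ![s, u])) := by
      have hF : Continuous fun q : ℝ × ℝ => F ![q.1, q.2] := by
        refine hc.comp (continuous_pi fun i => ?_)
        fin_cases i <;> simp <;> fun_prop
      exact (by fun_prop : Continuous fun q : ℝ × ℝ => Real.cos (k * q.1)).mul
        ((by fun_prop : Continuous fun q : ℝ × ℝ => Real.cos (l * q.2)).mul hF)
    exact (hcont.continuousOn.integrableOn_compact
      ((isCompact_uIcc (a := -π) (b := π)).prod (isCompact_uIcc (a := -π) (b := π)))).mono_set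
      (Set.prod_mono Set.uIoc_subset_uIcc Set.uIoc_subset_uIcc)

/-- **(J1) The frame presentation of the Jackson mean**: `(jacksonFrame d F)(p) = (𝒥_d F)(p)` for `F` continuous, `2π`-periodic,
reflection- and swap-symmetric (a symmetric frame). -/
theorem eval_jacksonFrame (hc : Continuous F)
    (hper : ∀ (p : Fin 2 → ℝ) (z : Fin 2 → ℤ), F (fun i => p i + z i * (2 * π)) = F p)
    (hrefl : ∀ p : Fin 2 → ℝ, F ![p 0, -p 1] = F p) (hswap : ∀ p : Fin 2 → ℝ, F ![p 1, p 0] = F p)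
    (d : ℕ) (p : Fin 2 → ℝ) : (jacksonFrame d F).eval p = jsmooth d F p := by
  rw [jsmooth_eq_sum hc hper hrefl hswap, TrigPolyC4v.eval_def]
  simp only [jacksonFrame, TrigPolyC4v.harmonic]
  -- split the symmetrised harmonic into its two halves
  have hsplit : ∀ m n : ℕ, jkerCoeff d m * jkerCoeff d n * cosMoment F m n *
      ((Real.cos (m * p 0) * Real.cos (n * p 1) + Real.cos (n * p 0) * Real.cos (m * p 1)) / 2) =
      jkerCoeff d m * jkerCoeff d n * cosMoment F m n * (Real.cos (m * p 0) * Real.cos (n * p 1)) / 2 +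
        jkerCoeff d m * jkerCoeff d n * cosMoment F m n * (Real.cos (n * p 0) * Real.cos (m * p 1)) / 2 := by
    intro m n; ring
  simp_rw [hsplit, Finset.sum_add_distrib]
  -- the second half equals the first after swapping the summation indices (symmetry of the coefficients)
  have hswapSum : ∑ m ∈ range (d + d + 1), ∑ n ∈ range (d + d + 1),
      jkerCoeff d m * jkerCoeff d n * cosMoment F m n * (Real.cos (n * p 0) * Real.cos (m * p 1)) / 2 =
      ∑ m ∈ range (d + d + 1), ∑ n ∈ range (d + d + 1),
        jkerCoeff d m * jkerCoeff d n * cosMoment F m n * (Real.cos (m * p 0) * Real.cos (n * p 1)) / 2 := by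
    rw [Finset.sum_comm]
    refine Finset.sum_congr rfl fun m _ => Finset.sum_congr rfl fun n _ => ?_
    rw [cosMoment_symm hc hswap n m]; ring
  rw [hswapSum, ← Finset.sum_add_distrib]
  refine Finset.sum_congr rfl fun m _ => ?_
  rw [← Finset.sum_add_distrib]
  exact Finset.sum_congr rfl fun n _ => by ring

end Symmetric

end Summit.HubbardSuperconductivity.HubbardSuperconductivity.Theorems.KLRegimeSplit

end
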